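import Literature.Analysis.FluidPDE.CollisionalTransfer
import Literature.Analysis.FunctionSpaces.TorusCalculusProofs
import Literature.MathematicalPhysics.KineticTheory.HardSphereEulerProofs
import Summits.AtomisticToContinuum.HydrodynamicLimit.Theorems.CollisionIsometryCLTMesoscopicLLNKernels
import Summits.AtomisticToContinuum.HydrodynamicLimit.Theorems.AnnealedZeroHorizonMeanFluxClosureStreamingStressCommutator
import HarnessLib

/-!
# Crux `MeanFluxClosure` (stmt-AtomisticToContinuum-9256), line `registered` — stub KS-b
# (deviatoric kinetic-stress closure), part 1: the exact Reynolds/trace identity and the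
# pointwise Cauchy–Schwarz bounds

Support file (`--supports stmt-AtomisticToContinuum-9256`) for the stub
`stub_deviatoricStressClosure` (KS-b) of the lead's skeleton of
`Summit.AtomisticToContinuum.HydrodynamicLimit.Theses.AnnealedZeroHorizon.MeanFluxClosure`.
The stub asserts `E[T_φ − J_φ] → 0` where, along the hard-sphere flow and for a probability
kernel `k ≥ 0`, `T_φ = ∫∫ (N+1)⁻¹Σ_a k(x−x_a) Σ_ij v_a^iv_a^j ∂_jφ_i dx ds` (mollified kinetic
stress tested with `∇φ`) and `J_φ = ∫∫ [Σ_ij (Mv_iMv_j/R) ∂_jφ_i + RΘ div φ] dx ds` (IDEAL Euler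
stress of the mollified empirical density/momentum/energy `R, Mv, En`,
`Θ = ⅔(En/R − ‖Mv‖²/(2R²))`, real division, junk `0` at `R = 0`). For a general configuration
`w : Config n (Fin 3) 𝕋³`, point `x` and kernel `k ≥ 0` (incl. the degenerate case `R = 0`):

* `stress_sub_idealStress_eq_deviatoric` — the EXACT scale-`ℓ` Reynolds/trace identity
  `n⁻¹Σ_a k(x−x_a) v_a^iv_a^j − (Mv_iMv_j/R + δ_ij RΘ) = P_ij − δ_ij (Σ_l P_ll)/3`,
  `P_ij = n⁻¹Σ_a k(x−x_a)(v_a^i − Mv_i/R)(v_a^j − Mv_j/R)` the scale-`ℓ` peculiar stress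
  (`tr P = 2En − ‖Mv‖²/R = 3RΘ`); contracted with `∇φ` (`stressIntegrand_sub_idealIntegrand_eq`)
  and with the stub's `let`-bound fields written out (registered sub-goal
  `stub_deviatoricStressClosure_identity`): the stub's integrand
  IS the traceless peculiar stress tested with `∇φ` — the general stub is isotropy in mean of the
  scale-`ℓ` peculiar velocity covariance along the deterministic dynamics;
* `norm_sq_momentum_le` (`‖Mv‖² ≤ 2 R En`), `abs_reynolds_le_and_abs_pressure_le`,
  `abs_idealIntegrand_le`, `abs_stressIntegrand_le` — both integrands are dominated by the
  mollified kinetic energy; `abs_integral_stressIntegrand_le`, `abs_integral_idealIntegrand_le` —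
  after `∫_x` both observables are at most `9C`, resp. `10C`, times `n⁻¹Σ_a‖v_a‖²`.

Part 2 (`…B.lean`): integrability of the stub's functional at every `N`. No definitions.
References: Spohn, *Large Scale Dynamics of Interacting Particles* (1991), Part I Ch. 3.
-/

noncomputable section

namespace Summit.AtomisticToContinuum.HydrodynamicLimit.Theorems

open scoped BigOperators ENNReal Topology InnerProductSpace
open MeasureTheory Set Filter
open Literature.Analysis.FluidPDE Literature.Analysis.FunctionSpaces
open Literature.MathematicalPhysics.KineticTheory

namespace DeviatoricStressClosure

/-! ### The exact scale-`ℓ` Reynolds/trace identity (pure algebra) -/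

/-- Coordinates of the mollified empirical momentum: `Mv_l = n⁻¹ Σ_a k(x − x_a) v_a^l`. [folklore] -/
theorem empiricalMomentumField_apply {n : ℕ} (w : Config n (Fin 3) T3) (χ : T3 → ℝ) (l : Fin 3) :
    empiricalMomentumField w χ l = (n : ℝ)⁻¹ * ∑ a, χ (w a).1 * (w a).2 l := by
  rw [empiricalMomentumField_eq_sum]
  simp only [PiLp.smul_apply, WithLp.ofLp_sum, Finset.sum_apply, smul_eq_mul]

/-- Expansion of the scale-`ℓ` peculiar stress around an arbitrary reference velocity:
`n⁻¹Σ_a k_a (v_a^i − p)(v_a^j − q) = S_ij − q M_i − p M_j + p q R`. [folklore] -/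
theorem avg_mul_sub_mul_sub_eq {n : ℕ} (κ : Fin n → ℝ) (v : Fin n → V3) (c p q : ℝ) (i j : Fin 3) :
    c * ∑ a, κ a * ((v a i - p) * (v a j - q)) =
      c * ∑ a, κ a * (v a i * v a j) - q * (c * ∑ a, κ a * v a i) -
        p * (c * ∑ a, κ a * v a j) + p * q * (c * ∑ a, κ a) := by
  have h : ∀ a, κ a * ((v a i - p) * (v a j - q)) =
      κ a * (v a i * v a j) - q * (κ a * v a i) - p * (κ a * v a j) + p * q * κ a := fun a => by ring
  simp_rw [h, Finset.sum_add_distrib, Finset.sum_sub_distrib, ← Finset.mul_sum]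
  ring

/-- The trace of the mollified kinetic stress is twice the mollified energy:
`Σ_l n⁻¹Σ_a k_a v_a^l v_a^l = 2 · n⁻¹Σ_a k_a ‖v_a‖²/2`. [folklore] -/
theorem sum_avg_mul_self_eq {n : ℕ} (κ : Fin n → ℝ) (v : Fin n → V3) (c : ℝ) :
    ∑ l, c * ∑ a, κ a * (v a l * v a l) = 2 * (c * ∑ a, κ a * (‖v a‖ ^ 2 / 2)) := by
  simp only [Finset.mul_sum]
  rw [Finset.sum_comm]
  refine Finset.sum_congr rfl fun a _ => ?_
  rw [EuclideanSpace.real_norm_sq_eq, Finset.sum_div, Finset.mul_sum, Finset.mul_sum, Finset.mul_sum]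
  exact Finset.sum_congr rfl fun l _ => by ring

/-- **The exact scale-`ℓ` Reynolds/trace identity, componentwise.** For every configuration `w`,
point `x` and kernel `k ≥ 0`, with `R, Mv, En` the `k(x − ·)`-mollified empirical density,
momentum and energy of `w` and `Θ = ⅔(En/R − ‖Mv‖²/(2R²))` (real division, junk `0` at `R = 0`):
`n⁻¹Σ_a k(x−x_a) v_a^i v_a^j − (Mv_i Mv_j/R + δ_ij RΘ) = P_ij − δ_ij (Σ_l P_ll)/3`, where
`P_ij = n⁻¹Σ_a k(x−x_a)(v_a^i − Mv_i/R)(v_a^j − Mv_j/R)` is the scale-`ℓ` peculiar stress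
(`tr P = 2En − ‖Mv‖²/R = 3RΘ`; at `R = 0` all weights `k(x − x_a)` vanish since `k ≥ 0`). [folklore] -/
theorem stress_sub_idealStress_eq_deviatoric {n : ℕ} (w : Config n (Fin 3) T3) (x : T3)
    {k : T3 → ℝ} (hk0 : ∀ y, 0 ≤ k y) {R En : ℝ} {Mv : V3}
    (hR : R = empiricalDensityField w (fun y => k (x - y)))
    (hMv : Mv = empiricalMomentumField w (fun y => k (x - y)))
    (hEn : En = empiricalEnergyField w (fun y => k (x - y))) (i j : Fin 3) :
    (n : ℝ)⁻¹ * ∑ a, k (x - (w a).1) * ((w a).2 i * (w a).2 j) -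
        (Mv i * Mv j / R +
          (if i = j then 1 else 0) * (R * (2 / 3 * (En / R - ‖Mv‖ ^ 2 / (2 * R ^ 2))))) =
      (n : ℝ)⁻¹ * ∑ a, k (x - (w a).1) * (((w a).2 i - Mv i / R) * ((w a).2 j - Mv j / R)) -
        (if i = j then 1 else 0) *
          ((∑ l, (n : ℝ)⁻¹ * ∑ a, k (x - (w a).1) * (((w a).2 l - Mv l / R) *
            ((w a).2 l - Mv l / R))) / 3) := by
  set c : ℝ := (n : ℝ)⁻¹ with hc
  have hRs : R = c * ∑ a, k (x - (w a).1) := by rw [hR, empiricalDensityField_eq_sum]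
  have hMvl : ∀ l, Mv l = c * ∑ a, k (x - (w a).1) * (w a).2 l := fun l => by
    rw [hMv, empiricalMomentumField_apply]
  have hEns : En = c * ∑ a, k (x - (w a).1) * (‖(w a).2‖ ^ 2 / 2) := by
    rw [hEn, empiricalEnergyField_eq_sum]
  rcases eq_or_ne R 0 with hR0 | hR0
  · -- degenerate case: all weights vanish (or `n = 0`)
    have hck : ∀ a, c * k (x - (w a).1) = 0 := by
      intro a
      rcases mul_eq_zero.1 (hRs.symm.trans hR0) with h0 | h0
      · rw [h0, zero_mul]
      · rw [(Finset.sum_eq_zero_iff_of_nonneg fun b _ => hk0 _).1 h0 a (Finset.mem_univ a), mul_zero]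
    have hvan : ∀ f : Fin n → ℝ, c * ∑ a, k (x - (w a).1) * f a = 0 := fun f => by
      rw [Finset.mul_sum]
      exact Finset.sum_eq_zero fun a _ => by rw [← mul_assoc, hck a, zero_mul]
    simp only [hR0, div_zero, zero_mul, mul_zero, add_zero, sub_zero, hvan, Finset.sum_const_zero,
      zero_div]
  · -- generic case: expand `P` and its trace
    have hP : ∀ i j, c * ∑ a, k (x - (w a).1) * (((w a).2 i - Mv i / R) * ((w a).2 j - Mv j / R)) =
        c * ∑ a, k (x - (w a).1) * ((w a).2 i * (w a).2 j) - Mv i * Mv j / R := by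
      intro i j
      rw [avg_mul_sub_mul_sub_eq, ← hMvl i, ← hMvl j, ← hRs]
      field_simp
      ring
    have htr : ∑ l, c * ∑ a, k (x - (w a).1) * (((w a).2 l - Mv l / R) * ((w a).2 l - Mv l / R)) =
        2 * En - ‖Mv‖ ^ 2 / R := by
      simp_rw [hP]
      rw [Finset.sum_sub_distrib, sum_avg_mul_self_eq, ← hEns, EuclideanSpace.real_norm_sq_eq,
        Finset.sum_div]
      simp only [sq, mul_div_assoc]
    rw [htr, hP]
    split_ifs
    · field_simp
      ring
    · ring

/-- **The exact identity, contracted with `∇φ`** (the integrands of the stub): for every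
configuration, point, kernel `k ≥ 0` and test field `φ`,
`n⁻¹Σ_a k(x−x_a) Σ_ij v_a^i v_a^j ∂_jφ_i(x) − (Σ_ij (Mv_iMv_j/R) ∂_jφ_i(x) + RΘ div φ(x))
  = Σ_ij (P_ij − δ_ij tr P/3) ∂_jφ_i(x)` — the mollified kinetic stress minus the ideal Euler
stress of the mollified fields, tested with `∇φ`, is the traceless (deviatoric) part of the
scale-`ℓ` peculiar stress tested with `∇φ`. [folklore] -/
theorem stressIntegrand_sub_idealIntegrand_eq {n : ℕ} (w : Config n (Fin 3) T3) (x : T3)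
    {k : T3 → ℝ} (hk0 : ∀ y, 0 ≤ k y) (φ : T3 → V3) {R En : ℝ} {Mv : V3}
    (hR : R = empiricalDensityField w (fun y => k (x - y)))
    (hMv : Mv = empiricalMomentumField w (fun y => k (x - y)))
    (hEn : En = empiricalEnergyField w (fun y => k (x - y))) :
    (n : ℝ)⁻¹ * ∑ a, k (x - (w a).1) * (∑ i, ∑ j, (w a).2 i * (w a).2 j *
        Torus.partialDeriv j (fun y => φ y i) x) -
      ((∑ i, ∑ j, (Mv i * Mv j / R) * Torus.partialDeriv j (fun y => φ y i) x) +
        R * (2 / 3 * (En / R - ‖Mv‖ ^ 2 / (2 * R ^ 2))) * Torus.divergence φ x) =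
    ∑ i, ∑ j, ((n : ℝ)⁻¹ * ∑ a, k (x - (w a).1) * (((w a).2 i - Mv i / R) * ((w a).2 j - Mv j / R)) -
        (if i = j then 1 else 0) *
          ((∑ l, (n : ℝ)⁻¹ * ∑ a, k (x - (w a).1) * (((w a).2 l - Mv l / R) *
            ((w a).2 l - Mv l / R))) / 3)) * Torus.partialDeriv j (fun y => φ y i) x := by
  have hT : (n : ℝ)⁻¹ * ∑ a, k (x - (w a).1) * (∑ i, ∑ j, (w a).2 i * (w a).2 j *
      Torus.partialDeriv j (fun y => φ y i) x) =
      ∑ i, ∑ j, ((n : ℝ)⁻¹ * ∑ a, k (x - (w a).1) * ((w a).2 i * (w a).2 j)) *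
        Torus.partialDeriv j (fun y => φ y i) x := by
    simp only [Finset.mul_sum, Finset.sum_mul]
    rw [Finset.sum_comm]
    refine Finset.sum_congr rfl fun i _ => ?_
    rw [Finset.sum_comm]
    exact Finset.sum_congr rfl fun j _ => Finset.sum_congr rfl fun a _ => by ring
  have hdiv : ∀ Q : ℝ, Q * Torus.divergence φ x =
      ∑ i, ∑ j, ((if i = j then 1 else 0) * Q) * Torus.partialDeriv j (fun y => φ y i) x := by
    intro Q
    simp only [Torus.divergence, Finset.mul_sum, ite_mul, zero_mul, one_mul, Finset.sum_ite_eq,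
      Finset.mem_univ, if_true]
  rw [hT, hdiv, ← Finset.sum_add_distrib, ← Finset.sum_sub_distrib]
  refine Finset.sum_congr rfl fun i _ => ?_
  rw [← Finset.sum_add_distrib, ← Finset.sum_sub_distrib]
  refine Finset.sum_congr rfl fun j _ => ?_
  rw [← add_mul, ← sub_mul, stress_sub_idealStress_eq_deviatoric w x hk0 hR hMv hEn i j]

/-! ### Pointwise bounds (Cauchy–Schwarz; all fine at `R = 0`) -/

/-- **Cauchy–Schwarz for the mollified fields**: `‖Mv‖² ≤ 2 R En` (weights `k ≥ 0`). [folklore] -/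
theorem norm_sq_momentum_le {n : ℕ} (w : Config n (Fin 3) T3) (x : T3) {k : T3 → ℝ}
    (hk0 : ∀ y, 0 ≤ k y) {R En : ℝ} {Mv : V3}
    (hR : R = empiricalDensityField w (fun y => k (x - y)))
    (hMv : Mv = empiricalMomentumField w (fun y => k (x - y)))
    (hEn : En = empiricalEnergyField w (fun y => k (x - y))) : ‖Mv‖ ^ 2 ≤ 2 * R * En := by
  set c : ℝ := (n : ℝ)⁻¹ with hc
  have hc0 : 0 ≤ c := inv_nonneg.2 (Nat.cast_nonneg n)
  have hRs : R = c * ∑ a, k (x - (w a).1) := by rw [hR, empiricalDensityField_eq_sum]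
  have hEns : En = c * ∑ a, k (x - (w a).1) * (‖(w a).2‖ ^ 2 / 2) := by
    rw [hEn, empiricalEnergyField_eq_sum]
  have hnorm : ‖Mv‖ ≤ c * ∑ a, k (x - (w a).1) * ‖(w a).2‖ := by
    rw [hMv, empiricalMomentumField_eq_sum, norm_smul, Real.norm_eq_abs, abs_of_nonneg hc0]
    refine mul_le_mul_of_nonneg_left ((norm_sum_le _ _).trans (Finset.sum_le_sum fun a _ => ?_)) hc0
    rw [norm_smul, Real.norm_eq_abs, abs_of_nonneg (hk0 _)]
  have hCS : (∑ a, k (x - (w a).1) * ‖(w a).2‖) ^ 2 ≤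
      (∑ a, k (x - (w a).1)) * ∑ a, k (x - (w a).1) * ‖(w a).2‖ ^ 2 :=
    Finset.sum_sq_le_sum_mul_sum_of_sq_le_mul _ (fun a _ => hk0 _)
      (fun a _ => mul_nonneg (hk0 _) (sq_nonneg _)) (fun a _ => by ring_nf; rfl)
  calc ‖Mv‖ ^ 2 ≤ (c * ∑ a, k (x - (w a).1) * ‖(w a).2‖) ^ 2 :=
        pow_le_pow_left₀ (norm_nonneg _) hnorm 2
    _ = c * c * (∑ a, k (x - (w a).1) * ‖(w a).2‖) ^ 2 := by ring
    _ ≤ c * c * ((∑ a, k (x - (w a).1)) * ∑ a, k (x - (w a).1) * ‖(w a).2‖ ^ 2) :=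
        mul_le_mul_of_nonneg_left hCS (mul_nonneg hc0 hc0)
    _ = 2 * R * En := by
        have h2 : ∑ a, k (x - (w a).1) * (‖(w a).2‖ ^ 2 / 2) =
            (∑ a, k (x - (w a).1) * ‖(w a).2‖ ^ 2) / 2 := by
          rw [Finset.sum_div]
          exact Finset.sum_congr rfl fun a _ => by ring
        rw [hRs, hEns, h2]
        ring

/-- **The mollified fields' Reynolds and pressure terms are dominated by the energy:**
`0 ≤ R`, `0 ≤ En`, `|Mv_iMv_j/R| ≤ 2En` and `|RΘ| ≤ ⅔En` (`RΘ = ⅔En − ‖Mv‖²/(3R) ∈ [0, ⅔En]` by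
Cauchy–Schwarz; everything is `0` at `R = 0`). [folklore] -/
theorem abs_reynolds_le_and_abs_pressure_le {n : ℕ} (w : Config n (Fin 3) T3) (x : T3)
    {k : T3 → ℝ} (hk0 : ∀ y, 0 ≤ k y) {R En : ℝ} {Mv : V3}
    (hR : R = empiricalDensityField w (fun y => k (x - y)))
    (hMv : Mv = empiricalMomentumField w (fun y => k (x - y)))
    (hEn : En = empiricalEnergyField w (fun y => k (x - y))) :
    0 ≤ R ∧ 0 ≤ En ∧ (∀ i j, |Mv i * Mv j / R| ≤ 2 * En) ∧
      |R * (2 / 3 * (En / R - ‖Mv‖ ^ 2 / (2 * R ^ 2)))| ≤ 2 / 3 * En := by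
  have hc0 : 0 ≤ (n : ℝ)⁻¹ := inv_nonneg.2 (Nat.cast_nonneg n)
  have hR0 : 0 ≤ R := by
    rw [hR, empiricalDensityField_eq_sum]
    exact mul_nonneg hc0 (Finset.sum_nonneg fun a _ => hk0 _)
  have hEn0 : 0 ≤ En := by
    rw [hEn, empiricalEnergyField_eq_sum]
    exact mul_nonneg hc0 (Finset.sum_nonneg fun a _ => mul_nonneg (hk0 _) (by positivity))
  have hCS := norm_sq_momentum_le w x hk0 hR hMv hEn
  have hq : ‖Mv‖ ^ 2 / R ≤ 2 * En := by
    rcases hR0.eq_or_lt with h | h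
    · rw [← h, div_zero]
      linarith
    · rw [div_le_iff₀ h]
      linarith
  have hq0 : 0 ≤ ‖Mv‖ ^ 2 / R := div_nonneg (sq_nonneg _) hR0
  refine ⟨hR0, hEn0, fun i j => ?_, ?_⟩
  · rw [abs_div, abs_mul, abs_of_nonneg hR0]
    have hvi : ∀ l, |Mv l| ≤ ‖Mv‖ := fun l =>
      (Real.norm_eq_abs _).symm.trans_le (PiLp.norm_apply_le Mv l)
    calc |Mv i| * |Mv j| / R ≤ ‖Mv‖ * ‖Mv‖ / R :=
          div_le_div_of_nonneg_right (mul_le_mul (hvi i) (hvi j) (abs_nonneg _) (norm_nonneg _)) hR0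
      _ = ‖Mv‖ ^ 2 / R := by rw [sq]
      _ ≤ 2 * En := hq
  · rcases hR0.eq_or_lt with h | h
    · rw [← h, zero_mul, abs_zero]
      linarith
    · have h' : R * (2 / 3 * (En / R - ‖Mv‖ ^ 2 / (2 * R ^ 2))) =
          2 / 3 * En - ‖Mv‖ ^ 2 / R / 3 := by
        field_simp
      rw [h', abs_le]
      constructor <;> linarith

/-- **Bound on the ideal Euler stress of the mollified fields tested with `∇φ`:**
`|Σ_ij (Mv_iMv_j/R) ∂_jφ_i + RΘ div φ| ≤ 20 C En` when `|∂_jφ_i| ≤ C` (`|div φ| ≤ 3C`). [folklore] -/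
theorem abs_idealIntegrand_le {n : ℕ} (w : Config n (Fin 3) T3) (x : T3) {k : T3 → ℝ}
    (hk0 : ∀ y, 0 ≤ k y) {φ : T3 → V3} {C : ℝ}
    (hC : ∀ i j y, |Torus.partialDeriv j (fun y => φ y i) y| ≤ C) {R En : ℝ} {Mv : V3}
    (hR : R = empiricalDensityField w (fun y => k (x - y)))
    (hMv : Mv = empiricalMomentumField w (fun y => k (x - y)))
    (hEn : En = empiricalEnergyField w (fun y => k (x - y))) :
    |(∑ i, ∑ j, (Mv i * Mv j / R) * Torus.partialDeriv j (fun y => φ y i) x) +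
        R * (2 / 3 * (En / R - ‖Mv‖ ^ 2 / (2 * R ^ 2))) * Torus.divergence φ x| ≤
      20 * C * En := by
  obtain ⟨-, hEn0, h1, h2⟩ := abs_reynolds_le_and_abs_pressure_le w x hk0 hR hMv hEn
  have hC0 : 0 ≤ C := (abs_nonneg _).trans (hC 0 0 x)
  have hdiv : |Torus.divergence φ x| ≤ 3 * C := by
    unfold Torus.divergence
    calc |∑ i, Torus.partialDeriv i (fun y => φ y i) x|
        ≤ ∑ i, |Torus.partialDeriv i (fun y => φ y i) x| := Finset.abs_sum_le_sum_abs _ _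
      _ ≤ ∑ _i : Fin 3, C := Finset.sum_le_sum fun i _ => hC i i x
      _ = 3 * C := by simp
  calc |(∑ i, ∑ j, Mv i * Mv j / R * Torus.partialDeriv j (fun y => φ y i) x) +
          R * (2 / 3 * (En / R - ‖Mv‖ ^ 2 / (2 * R ^ 2))) * Torus.divergence φ x|
      ≤ |∑ i, ∑ j, Mv i * Mv j / R * Torus.partialDeriv j (fun y => φ y i) x| +
          |R * (2 / 3 * (En / R - ‖Mv‖ ^ 2 / (2 * R ^ 2))) * Torus.divergence φ x| := abs_add_le _ _
    _ ≤ (∑ _i : Fin 3, ∑ _j : Fin 3, 2 * En * C) + 2 / 3 * En * (3 * C) := by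
        refine add_le_add ?_ ?_
        · refine (Finset.abs_sum_le_sum_abs _ _).trans (Finset.sum_le_sum fun i _ => ?_)
          refine (Finset.abs_sum_le_sum_abs _ _).trans (Finset.sum_le_sum fun j _ => ?_)
          rw [abs_mul]
          exact mul_le_mul (h1 i j) (hC i j x) (abs_nonneg _) (by linarith)
        · rw [abs_mul]
          exact mul_le_mul h2 hdiv (abs_nonneg _) (by linarith)
    _ = 20 * C * En := by
        simp only [Finset.sum_const, Finset.card_univ, Fintype.card_fin]
        ring

/-- **Bound on the mollified kinetic stress tested with `∇φ`:**
`|c Σ_a k_a Σ_ij v_a^i v_a^j ∂_jφ_i(x)| ≤ 9 C c Σ_a k_a ‖v_a‖²` (`c ≥ 0`, `k ≥ 0`). [folklore] -/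
theorem abs_stressIntegrand_le {n : ℕ} (w : Config n (Fin 3) T3) (x : T3) {k : T3 → ℝ}
    (hk0 : ∀ y, 0 ≤ k y) {φ : T3 → V3} {C : ℝ}
    (hC : ∀ i j y, |Torus.partialDeriv j (fun y => φ y i) y| ≤ C) {c : ℝ} (hc : 0 ≤ c) :
    |c * ∑ a, k (x - (w a).1) * (∑ i, ∑ j, (w a).2 i * (w a).2 j *
        Torus.partialDeriv j (fun y => φ y i) x)| ≤
      9 * C * (c * ∑ a, k (x - (w a).1) * ‖(w a).2‖ ^ 2) := by
  rw [abs_mul, abs_of_nonneg hc]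
  have h9 : 9 * C * (c * ∑ a, k (x - (w a).1) * ‖(w a).2‖ ^ 2) =
      c * ∑ a, k (x - (w a).1) * (∑ _i : Fin 3, ∑ _j : Fin 3, ‖(w a).2‖ ^ 2 * C) := by
    simp only [Finset.sum_const, Finset.card_univ, Fintype.card_fin, Finset.mul_sum]
    exact Finset.sum_congr rfl fun a _ => by ring
  rw [h9]
  refine mul_le_mul_of_nonneg_left ((Finset.abs_sum_le_sum_abs _ _).trans
    (Finset.sum_le_sum fun a _ => ?_)) hc
  rw [abs_mul, abs_of_nonneg (hk0 _)]
  refine mul_le_mul_of_nonneg_left ((Finset.abs_sum_le_sum_abs _ _).trans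
    (Finset.sum_le_sum fun i _ => (Finset.abs_sum_le_sum_abs _ _).trans
      (Finset.sum_le_sum fun j _ => ?_))) (hk0 _)
  rw [abs_mul, abs_mul, sq]
  have hvi : ∀ l, |(w a).2 l| ≤ ‖(w a).2‖ := fun l =>
    (Real.norm_eq_abs _).symm.trans_le (PiLp.norm_apply_le _ l)
  exact mul_le_mul (mul_le_mul (hvi i) (hvi j) (abs_nonneg _)
    (norm_nonneg _)) (hC i j x) (abs_nonneg _) (mul_nonneg (norm_nonneg _) (norm_nonneg _))

/-! ### Space integrals: the two observables -/

/-- `∫_x c Σ_a k(x − x_a) f_a dx = c Σ_a f_a` for a continuous kernel of mass one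
(translation invariance of the Haar measure). [folklore] -/
theorem integral_avg_kernel_mul {n : ℕ} (w : Config n (Fin 3) T3) {k : T3 → ℝ}
    (hkc : Continuous k) (hk1 : ∫ y, k y = 1) (c : ℝ) (f : Fin n → ℝ) :
    ∫ x, c * ∑ a, k (x - (w a).1) * f a = c * ∑ a, f a := by
  rw [integral_const_mul, integral_finsetSum _ fun a _ => ?_]
  · congr 1
    refine Finset.sum_congr rfl fun a _ => ?_
    rw [integral_mul_const, MesoLLN.integral_comp_sub_right k (w a).1, hk1, one_mul]
  · exact (integrable_of_continuous_T3 (hkc.comp (continuous_id.sub continuous_const))).mul_const _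

/-- **The mollified kinetic stress observable is dominated by the kinetic energy:**
`|∫_x c Σ_a k(x−x_a) Σ_ij v_a^iv_a^j ∂_jφ_i dx| ≤ 9 C c Σ_a ‖v_a‖²`. [folklore] -/
theorem abs_integral_stressIntegrand_le {n : ℕ} (w : Config n (Fin 3) T3) {k : T3 → ℝ}
    (hkc : Continuous k) (hk0 : ∀ y, 0 ≤ k y) (hk1 : ∫ y, k y = 1) {φ : T3 → V3} {C : ℝ}
    (hC : ∀ i j y, |Torus.partialDeriv j (fun y => φ y i) y| ≤ C) {c : ℝ} (hc : 0 ≤ c) :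
    |∫ x, c * ∑ a, k (x - (w a).1) * (∑ i, ∑ j, (w a).2 i * (w a).2 j *
        Torus.partialDeriv j (fun y => φ y i) x)| ≤ 9 * C * (c * ∑ a, ‖(w a).2‖ ^ 2) := by
  have hg : Integrable (fun x => 9 * C * (c * ∑ a, k (x - (w a).1) * ‖(w a).2‖ ^ 2)) :=
    integrable_of_continuous_T3 (continuous_const.mul (continuous_const.mul
      (continuous_finsetSum _ fun a _ =>
        (hkc.comp (continuous_id.sub continuous_const)).mul continuous_const)))
  rw [← Real.norm_eq_abs]
  refine (norm_integral_le_of_norm_le hg (ae_of_all _ fun x => ?_)).trans_eq ?_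
  · rw [Real.norm_eq_abs]
    exact abs_stressIntegrand_le w x hk0 hC hc
  · rw [integral_const_mul, integral_avg_kernel_mul w hkc hk1]

/-- **The ideal-stress observable is dominated by the kinetic energy:**
`|∫_x [Σ_ij (Mv_iMv_j/R)∂_jφ_i + RΘ div φ] dx| ≤ 10 C n⁻¹ Σ_a ‖v_a‖²`
(`∫_x En dx = n⁻¹ Σ_a ‖v_a‖²/2`). [folklore] -/
theorem abs_integral_idealIntegrand_le {n : ℕ} (w : Config n (Fin 3) T3) {k : T3 → ℝ}
    (hkc : Continuous k) (hk0 : ∀ y, 0 ≤ k y) (hk1 : ∫ y, k y = 1) {φ : T3 → V3} {C : ℝ}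
    (hC : ∀ i j y, |Torus.partialDeriv j (fun y => φ y i) y| ≤ C) :
    |∫ x, (let R : ℝ := empiricalDensityField w (fun y => k (x - y))
      let Mv : V3 := empiricalMomentumField w (fun y => k (x - y))
      let En : ℝ := empiricalEnergyField w (fun y => k (x - y))
      let Θ : ℝ := 2 / 3 * (En / R - ‖Mv‖ ^ 2 / (2 * R ^ 2))
      (∑ i, ∑ j, (Mv i * Mv j / R) * Torus.partialDeriv j (fun y => φ y i) x) +
        R * Θ * Torus.divergence φ x)| ≤ 10 * C * ((n : ℝ)⁻¹ * ∑ a, ‖(w a).2‖ ^ 2) := by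
  have hg' : (fun x => 20 * C * empiricalEnergyField w (fun y => k (x - y))) =
      fun x => 20 * C * ((n : ℝ)⁻¹ * ∑ a, k (x - (w a).1) * (‖(w a).2‖ ^ 2 / 2)) :=
    funext fun x => by rw [empiricalEnergyField_eq_sum]
  have hg : Integrable (fun x => 20 * C * empiricalEnergyField w (fun y => k (x - y))) := by
    rw [hg']
    exact integrable_of_continuous_T3 (continuous_const.mul (continuous_const.mul
      (continuous_finsetSum _ fun a _ =>
        (hkc.comp (continuous_id.sub continuous_const)).mul continuous_const)))
  rw [← Real.norm_eq_abs]
  refine (norm_integral_le_of_norm_le hg (ae_of_all _ fun x => ?_)).trans_eq ?_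
  · rw [Real.norm_eq_abs]
    exact abs_idealIntegrand_le w x hk0 hC rfl rfl rfl
  · rw [hg', integral_const_mul, integral_avg_kernel_mul w hkc hk1, ← Finset.sum_div]
    ring

end DeviatoricStressClosure

open DeviatoricStressClosure in
/-- **Registered sub-goal `stub_deviatoricStressClosure_identity` of stub KS-b: the stub's
integrand IS the deviatoric peculiar stress tested with `∇φ`.** For every configuration `w`,
base point `x`, kernel `k ≥ 0` and vector field `φ`, the T-integrand minus the J-integrand of
`stub_deviatoricStressClosure` (the latter with its `let`-bound mollified fields `R, Mv, En, Θ`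
written out) equals `Σ_ij (P_ij − δ_ij tr P/3) ∂_jφ_i(x)`,
`P_ij = n⁻¹Σ_a k(x−x_a)(v_a^i − Mv_i/R)(v_a^j − Mv_j/R)` (`stressIntegrand_sub_idealIntegrand_eq`).
[folklore] -/
theorem stub_deviatoricStressClosure_identity : ∀ (n : ℕ) (w : Literature.Analysis.FluidPDE.Config n (Fin 3) Literature.MathematicalPhysics.KineticTheory.T3) (x : Literature.MathematicalPhysics.KineticTheory.T3) (k : Literature.MathematicalPhysics.KineticTheory.T3 → ℝ), (∀ y, 0 ≤ k y) → ∀ (φ : Literature.MathematicalPhysics.KineticTheory.T3 → Literature.MathematicalPhysics.KineticTheory.V3), (n : ℝ)⁻¹ * ∑ a, k (x - (w a).1) * (∑ i, ∑ j, (w a).2 i * (w a).2 j * Literature.Analysis.FunctionSpaces.Torus.partialDeriv j (fun y => φ y i) x) - ((∑ i, ∑ j, (Literature.MathematicalPhysics.KineticTheory.empiricalMomentumField w (fun y => k (x - y)) i * Literature.MathematicalPhysics.KineticTheory.empiricalMomentumField w (fun y => k (x - y)) j / Literature.MathematicalPhysics.KineticTheory.empiricalDensityField w (fun y => k (x - y)))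 * Literature.Analysis.FunctionSpaces.Torus.partialDeriv j (fun y => φ y i) x) + Literature.MathematicalPhysics.KineticTheory.empiricalDensityField w (fun y => k (x - y)) * (2 / 3 * (Literature.MathematicalPhysics.KineticTheory.empiricalEnergyField w (fun y => k (x - y)) / Literature.MathematicalPhysics.KineticTheory.empiricalDensityField w (fun y => k (x - y)) - ‖Literature.MathematicalPhysics.KineticTheory.empiricalMomentumField w (fun y => k (x - y))‖ ^ 2 / (2 * Literature.MathematicalPhysics.KineticTheory.empiricalDensityField w (fun y => k (x - y)) ^ 2))) * Literature.Analysis.FunctionSpaces.Torus.divergence φ x) = ∑ i, ∑ j, ((n : ℝ)⁻¹ * ∑ a, k (x - (w a).1) * (((w a).2 i - Literature.MathematicalPhysics.KineticTheory.empiricalMomentumField w (fun y => k (x - y)) i / Literature.MathematicalPhysics.KineticTheory.empiricalDensityField w (fun y => k (x - y))) * ((w a).2 j - Literature.MathematicalPhysics.KineticTheory.empiricalMomentumField w (fun y => k (x - y)) j / Literature.MathematicalPhysics.KineticTheory.empiricalDensityField w (fun y => k (x - y)))) - (if i = j then 1 else 0) * ((∑ l, (n : ℝ)⁻¹ * ∑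 a, k (x - (w a).1) * (((w a).2 l - Literature.MathematicalPhysics.KineticTheory.empiricalMomentumField w (fun y => k (x - y)) l / Literature.MathematicalPhysics.KineticTheory.empiricalDensityField w (fun y => k (x - y))) * ((w a).2 l - Literature.MathematicalPhysics.KineticTheory.empiricalMomentumField w (fun y => k (x - y)) l / Literature.MathematicalPhysics.KineticTheory.empiricalDensityField w (fun y => k (x - y))))) / 3)) * Literature.Analysis.FunctionSpaces.Torus.partialDeriv j (fun y => φ y i) x := by
  intro n w x k hk0 φ
  exact stressIntegrand_sub_idealIntegrand_eq w x hk0 φ rfl rfl rfl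

end Summit.AtomisticToContinuum.HydrodynamicLimit.Theorems

end
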